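import Literature.AnabelianGeometry.EtaleTheta.KummerFunctorialityCovariant

/-!
# Equivariant ISOMORPHISMS of pairs: the two legs of the `H¹`-cospan are isomorphisms

Companion of `KummerFunctorialityCovariant.lean` ([LANA2026Report] §6.1 pp. 31–32, [AbsTopIII] =
[MochizukiAbsTopIII2015] Def. 3.1 (ii) p. 67 "isomorphism … `(Π_k ↷ M_k̄) ⥲ (Π ↷ M)`", Prop. 3.2 (ii)
p. 71).  For a covariant equivariant morphism `(φ, ψ) : (G₁ ↷ A₁) → (G₂ ↷ A₂)` and subgroups
`H₁ ≤ G₁`, `H₂ ≤ G₂` with `φ(H₁) ≤ H₂`, the Kummer classes compare through the cospan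
`H¹(H₁, Λ(A₁)) —push→ H¹(H₁, res_φ Λ(A₂)) ←pull— H¹(H₂, Λ(A₂))` (`pullH1_kummerClass`).  Here:

* `cyclotome.map_bijective_of_bijective` : `Λ` of a bijective homomorphism is bijective;
* `EquivariantMorphism.isIso_pullH1` : if `φ| : H₁ → H₂` is bijective, `pull` is an isomorphism
  (Mathlib `groupCohomology.mapIso` along the group isomorphism, identity on coefficients);
* `EquivariantMorphism.isIso_pushH1` : if `ψ` is bijective, `push` is an isomorphism (`mapIso` along
  `id_{H₁}` with the cyclotome isomorphism `Λ(ψ)` on coefficients);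
* `EquivariantMorphism.comparisonIso` : when both hold — e.g. for an isomorphism of pairs and `H₂ = φ(H₁)` —
  the resulting isomorphism `H¹(H₁, Λ(A₁)) ≅ H¹(H₂, Λ(A₂))` (`push ≫ pull⁻¹`), and
  **`comparisonIso_kummerClass`** : it carries `κ_{H₁}(a)` to `κ_{H₂}(ψ a)`.

Consumers: the canonicity of the transported model Kummer theories of [AbsTopIII] Prop. 3.2 (ii)
(`AbsoluteAnabelian/MonoidKummerTransportCanonical.lean`).  Conventions as in `KummerClass.lean`
(everything in `Type`, discrete).  Classical Kummer theory; nothing here bears on [IUTchIII] Cor. 3.12.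
-/

namespace Literature.AnabelianGeometry.EtaleTheta

open groupCohomology CategoryTheory

namespace cyclotome

variable {A B C : Type*} [CommGroup A] [CommGroup B] [CommGroup C]

/-- `Λ` is functorial: `Λ(χ ∘ ψ) = Λ(χ) ∘ Λ(ψ)` (on elements). [cite: LANA2026Report, §6.1 p.32] -/
theorem map_map (ψ : A →* B) (χ : B →* C) (ζ : cyclotome A) :
    map χ (map ψ ζ) = map (χ.comp ψ) ζ :=
  Subtype.ext (funext fun _ => rfl)

/-- `Λ(id) = id` (on elements). [cite: LANA2026Report, §6.1 p.32] -/
theorem map_id_apply (ζ : cyclotome A) : map (MonoidHom.id A) ζ = ζ :=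
  Subtype.ext (funext fun _ => rfl)

/-- `Λ(ψ)` is injective when `ψ` is. [cite: LANA2026Report, §6.1 p.32] -/
theorem map_injective_of_injective (ψ : A →* B) (hψ : Function.Injective ψ) :
    Function.Injective (map ψ) := fun ζ ξ h =>
  Subtype.ext (funext fun n => hψ (by
    have hn := congrArg (fun η : cyclotome B => (η : ℕ+ → B) n) h
    simpa using hn))

/-- `Λ(ψ)` is bijective when `ψ` is (the inverse is `Λ(ψ⁻¹)`; cf. the tree's `cyclotome.mapEquiv` for the
bundled form). [cite: LANA2026Report, §6.1 p.32] -/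
theorem map_bijective_of_bijective (ψ : A →* B) (hψ : Function.Bijective ψ) :
    Function.Bijective (map ψ) := by
  refine ⟨map_injective_of_injective ψ hψ.1, fun ξ => ?_⟩
  let e : A ≃* B := MulEquiv.ofBijective ψ hψ
  refine ⟨map e.symm.toMonoidHom ξ, Subtype.ext (funext fun n => ?_)⟩
  change ψ (e.symm ((ξ : ℕ+ → B) n)) = (ξ : ℕ+ → B) n
  exact e.apply_symm_apply _

end cyclotome

namespace EquivariantMorphism

variable {G₁ A₁ G₂ A₂ : Type} [Group G₁] [CommGroup A₁] [MulDistribMulAction G₁ A₁]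
  [Group G₂] [CommGroup A₂] [MulDistribMulAction G₂ A₂] (c : EquivariantMorphism G₁ A₁ G₂ A₂)
  {H₁ : Subgroup G₁} {H₂ : Subgroup G₂} (hH : H₁.map c.groupHom ≤ H₂)

/-- **`pull` is an isomorphism when `φ| : H₁ → H₂` is bijective** (e.g. `φ` an isomorphism and
`H₂ = φ(H₁)`): it is the isomorphism `groupCohomology.mapIso` along the group isomorphism `H₂ ≃ H₁`
with the identity on the coefficients `Λ(A₂)`. [cite: MochizukiAbsTopIII2015, Definition 3.1 (ii) p.67] -/
theorem isIso_pullH1 (hbij : Function.Bijective (c.groupHomRestrict hH)) : IsIso (c.pullH1 hH) := by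
  let eH : H₁ ≃* H₂ := MulEquiv.ofBijective (c.groupHomRestrict hH) hbij
  let I : H1 (cyclotomeRep (A := A₂) H₂) ≅ H1 (c.resRep hH) :=
    groupCohomology.mapIso (A := c.resRep hH) (B := cyclotomeRep (A := A₂) H₂) eH.symm
      (LinearEquiv.refl ℤ _) (fun g => by
        ext v
        change (cyclotomeRep (A := A₂) H₂).ρ g v =
          (cyclotomeRep (A := A₂) H₂).ρ (c.groupHomRestrict hH (eH.symm g)) v
        rw [show c.groupHomRestrict hH (eH.symm g) = g from eH.apply_symm_apply g]) 1
  have hI : I.hom = c.pullH1 hH := by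
    change groupCohomology.map _ _ 1 = groupCohomology.map _ _ 1
    refine groupCohomology.map_congr ?_ ?_ 1
    · exact MonoidHom.ext fun x => by simp [eH]
    · rfl
  rw [← hI]
  infer_instance

/-- **`push` is an isomorphism when `ψ : A₁ → A₂` is bijective** (e.g. `(φ, ψ)` an isomorphism of
pairs): it is `groupCohomology.mapIso` along `id_{H₁}` with the cyclotome isomorphism `Λ(ψ)` on
coefficients. [cite: MochizukiAbsTopIII2015, Definition 3.1 (ii) p.67] -/
theorem isIso_pushH1 (hψ : Function.Bijective c.map) : IsIso (c.pushH1 hH) := by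
  let e' : (cyclotomeRep (A := A₁) H₁).V ≃ₗ[ℤ] (c.resRep hH).V :=
    LinearEquiv.ofBijective (c.cyclotomeHom hH).hom.toLinearMap
      (cyclotome.map_bijective_of_bijective c.map hψ)
  let I : H1 (cyclotomeRep (A := A₁) H₁) ≅ H1 (c.resRep hH) :=
    groupCohomology.mapIso (A := c.resRep hH) (B := cyclotomeRep (A := A₁) H₁) (MulEquiv.refl H₁)
      e' (fun g => by
        ext v
        exact c.cyclotome_map_smul (g : G₁) (Additive.toMul v)) 1
  have hI : I.hom = c.pushH1 hH := by
    change groupCohomology.map _ _ 1 = groupCohomology.map _ _ 1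
    refine groupCohomology.map_congr ?_ ?_ 1
    · exact MonoidHom.ext fun x => rfl
    · exact LinearMap.ext fun _ => rfl
  rw [← hI]
  infer_instance

/-- **The comparison isomorphism `H¹(H₁, Λ(A₁)) ≅ H¹(H₂, Λ(A₂))` of an equivariant morphism that is
bijective on `H₁ → H₂` and on `A₁ → A₂`** (in particular an ISOMORPHISM of pairs with `H₂ = φ(H₁)`):
`push ≫ pull⁻¹`. [cite: MochizukiAbsTopIII2015, Definition 3.1 (ii) p.67] -/
noncomputable def comparisonIso (hbij : Function.Bijective (c.groupHomRestrict hH)) (hψ : Function.Bijective c.map) :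
    H1 (cyclotomeRep (A := A₁) H₁) ≅ H1 (cyclotomeRep (A := A₂) H₂) :=
  haveI := c.isIso_pushH1 hH hψ
  haveI := c.isIso_pullH1 hH hbij
  asIso (c.pushH1 hH) ≪≫ (asIso (c.pullH1 hH)).symm

/-- Defining property of `comparisonIso`: `pull ∘ comparisonIso = push`. [cite: MochizukiAbsTopIII2015, Definition 3.1 (ii) p.67] -/
theorem pullH1_comparisonIso_hom_apply (hbij : Function.Bijective (c.groupHomRestrict hH))
    (hψ : Function.Bijective c.map) (x : H1 (cyclotomeRep (A := A₁) H₁)) :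
    c.pullH1 hH ((c.comparisonIso hH hbij hψ).hom x) = c.pushH1 hH x := by
  haveI := c.isIso_pushH1 hH hψ
  haveI := c.isIso_pullH1 hH hbij
  change ((c.comparisonIso hH hbij hψ).hom ≫ c.pullH1 hH) x = _
  rw [comparisonIso, Iso.trans_hom, Iso.symm_hom, asIso_hom, Category.assoc, asIso_inv, IsIso.inv_hom_id,
    Category.comp_id]

/-- `comparisonIso` is characterised by `pull (comparisonIso x) = push x`: any `y` with `pull y = push x` is `comparisonIso x`.
[cite: MochizukiAbsTopIII2015, Definition 3.1 (ii) p.67] -/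
theorem comparisonIso_hom_apply_eq_of_pullH1_eq (hbij : Function.Bijective (c.groupHomRestrict hH))
    (hψ : Function.Bijective c.map) (x : H1 (cyclotomeRep (A := A₁) H₁))
    (y : H1 (cyclotomeRep (A := A₂) H₂)) (hy : c.pullH1 hH y = c.pushH1 hH x) :
    (c.comparisonIso hH hbij hψ).hom x = y := by
  haveI := c.isIso_pullH1 hH hbij
  have hinj : Function.Injective (c.pullH1 hH) := (ConcreteCategory.bijective_of_isIso (c.pullH1 hH)).1
  exact hinj (by rw [c.pullH1_comparisonIso_hom_apply hH hbij hψ x, hy])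

variable [RootableBy A₁ ℕ] [RootableBy A₂ ℕ]

/-- **The comparison isomorphism carries Kummer classes to Kummer classes**: for `a ∈ A₁^{H₁}`,
`b ∈ A₂^{H₂}` with `ψ(a) = b`, `comparisonIso (κ_{H₁}(a)) = κ_{H₂}(b)` — the form of the naturality
`pullH1_kummerClass` when both legs of the cospan are invertible.
[cite: LANA2026Report, §6.1 p.32] -/
theorem comparisonIso_kummerClass (hbij : Function.Bijective (c.groupHomRestrict hH)) (hψ : Function.Bijective c.map)
    (a : invariants (A := A₁) H₁) (b : invariants (A := A₂) H₂) (hab : c.map a = b) :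
    (c.comparisonIso hH hbij hψ).hom (kummerClass H₁ a) = kummerClass H₂ b :=
  c.comparisonIso_hom_apply_eq_of_pullH1_eq hH hbij hψ _ _ (c.pullH1_kummerClass hH a b hab)

end EquivariantMorphism

end Literature.AnabelianGeometry.EtaleTheta
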